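import Summits.BirchSwinnertonDyer.Rank1Residual.ManinAdditive.NeronOmegaGenusHecke
import Literature.NumberTheory.EllipticCurves.CuspFormLFunction
import HarnessLib
import HarnessLib.Audit.Tags

/-!
# «THE Ω-DEFECT AT 9 ∥ N IS VISIBLE ON THE f_E-LINE IFF KODAIRA III*, AND ONLY IF f_E IS N/9-OLD MOD 3» — rows E-imc-173 / 174 / 175
# typed (cell `bsd-f2-manin`, planner `imc` g22 ENGINE 14/14d, MEMO-imc (28.18)–(28.19); T-imc-34; nothing asserted)

TYPER NOTE (typer g18, T-imc-34).  SOURCE = HOME/imc/kit-g22/Sketch-imc-g22f.lean v2 sha16 66ce2b1a608905d5 (93 l.; farm rc 0 · 0 err · 0 warn · 0 sorry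
per imc; BC7 3/3 CLEAN; ref1 §R137 by-name probes 7/7 CLEAN), landed VERBATIM except: (i) this note; (ii) namespace `…ManinAdditive.NeronOmegaGenusG22f`
folded to `…ManinAdditive.NeronOmegaGenus` (where E-165…172, 176 live); (iii) `import HarnessLib.Audit.CruxProbe` and the three `#h21_crux_probe` commands
dropped; (iv) three PROVED typer edges (§3): `omegaDefectVisibleOnlyIfOldCongruentAtNine_of_atThree` (E-175 ⟹ E-173: `27 ∤ N ⟹ 81 ∤ N`),
`omegaDefectVisible_of_IIIstar_of_exceptionalStar` (E-153a `NeronOmegaThree.OmegaDefectOfExceptionalStarAtThree` ⟹ the «III* ⟹ visible» half of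
E-174 at `9 ∥ N`: III* is in the Ω-defect class and `depth + 1 = ord₃ deg φ` gives `depth < ord₃ deg φ`), `isOmegaDefectClassAtThree_of_visible`
(E-174 ⟹ at `9 ∥ N` a visible defect lies in E-153a's class).  The «functional version of (28.17′)» asked for with T-imc-34 is E-imc-176
`OmegaLineDepthEqReducedOfAtkinLehnerNegAtNine`, typed by imc in Sketch-imc-g22e v3 and landed with T-imc-33 (`NewformTwistTypeAtNine.lean`) — not
repeated here.  Imports = the sketch's (route-independent leaf `NeronOmegaGenusHecke` + Literature) — ROUTE-INDEPENDENT.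

HONEST FRAMING.  LENS: imc (integrality of modular forms: the Ω-lattice `Ω₃(N)` vs `L_red(N)` at additive level `9M`, read on the `e_f`-projection
`lineIndex`).  STATUS: E-imc-173/175 are the per-curve E-facing shadows of the cell's Hecke-module law E-169/E-165 (the genus-comparison module
`G₃(9M)` is supported on `N/9`-old mod-3 eigensystems) — CONJECTURAL (certified ranges below); E-imc-174 is the cell's SHARP E-facing law at
`v₃(N) = 2` (refines E-153a, whose class at `v₃ = 2` is exactly III*) — CONJECTURAL; imc: beyond-print theorem NO.  New predicate
`IsModThreeEigenvectorFor M a x` («the mod-3 eigensystem `a` OCCURS in `S₂(Γ₀(M)) ⊗ 𝔽₃», over the tree's `integralCuspForms0`, `heckeT`, `cuspCoeff`).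
BC5 WITNESS: ENGINE 14 kit j326990, table HOME/imc/kit-g22/g22-eng14-curvesys-p3.txt sha16 0663e72e056a857b (506 optimal curves, 78 levels
`9 ∥ N ≤ 1300`, mod-3 Hecke labels at `ℓ ≤ 23`): III* 59/59 `σ^Ω = 1` ∧ system `N/9`-old ∧ no 3-isogeny; III 102/102 `σ^Ω = 0`; I_n* 345/345 `σ^Ω = 0`;
ENGINE 14d kit j327077, table g22-eng14d-curvesys-p3-v3.txt sha16 b993d12c0a07b1b7 (181 optimal curves at `27 ∥ N ≤ 1300`): `σ^Ω = 1 ⟹ N/9`-old mod 3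
72/72, unified `9 ∣ N, 81 ∤ N`: 131/131; ENGINE 14e (signed, g22-eng14e-signed-p3-v3.txt bbf668de764dbd29) 9/9.  REFUTER VERDICTS: ref1 §R137 (R-imc-69):
E-173/174/175 SURVIVE, KILLED 0; print placement: Kraus 1997 covers `p ≥ 5` only; `III = III* ⊗ χ₋₃ ⟹ ρ̄_III = ρ̄_{III*} ⊗ ω`; CORRECTION to the memo's
reading «k(III-member) = 4»: it is 6; E-side census `N < 5·10⁵`: optimal `9 ∥ N` 458427 (I₀* 85968, I_n* 263597, III 58132, III* 50730), optimal III* ⟹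
`ρ̄_{E,3}` irreducible 50730/50730 (E-174's stated failure mode — an Eisenstein III* — is EMPTY in range), rational weight-2 `N/9`-old partner for III*
29997 found / III_irr 0; Kodaira ↔ sign at `v₃(N) = 2` is PRINT (Kobayashi 2002 Thm 1.1(ii): III/III* ⟹ `w₃ = +1`, I₀*/I_n* ⟹ `−1`).  ref2: PENDING.
CHEAPEST FALSIFIERS (imc): a III* optimal curve at `9 ∥ N` with `σ^Ω = 0`, or a III / I_n* one with `σ^Ω = 1`; for E-173 a `σ^Ω = 1` curve whose system is
not `N/9`-old.  WHY IT MATTERS: at `9 ∥ N` the Ω-side Manin-at-3 residual of C3 (`ManinPrimeToThreeAtNine`, stmt-22968) is confined to exactly the III*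
curves, with a Galois/Hecke name (twist-minimal at 3, `ρ̄_{E,3}` from `S₂(Γ₀(N/9))`).  PARTITION currency: 0; beyond-print theorem: NO; bears_on:
stmt-BirchSwinnertonDyer-22968 (C3).  BSD is not proved by this; Manin's conjecture is not proved; C2/C3 OPEN.
[cite: Edixhoven2006IntegralStructures, Prop. 5 (shape of the Ω-lattice / `L_red` comparison at additive level; NOT these statements — `p² ∥ N` is deferred there)]
[cite: Kobayashi2002, Thm. 1.1(ii) (local root number at 3 from the Kodaira symbol: III, III* ⟹ `w₃ = +1`, I₀*, I_n* ⟹ `−1`; identifies E-174's Kodaira side with E-172's sign side — ref1 §R137)]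
[cite: Edixhoven1992, Thm. 4.5 (the weight in Serre's conjecture: `ρ̄` of weight 2 and prime-to-3 level `N/9` ⟺ finite flat at 3 — the print notion behind «`f_E` is `N/9`-old mod 3»; NOT these statements)]
-/

open scoped MatrixGroups ModularForm
open CongruenceSubgroup Literature.NumberTheory.EllipticCurves.ModularForms
  Summit.BirchSwinnertonDyer.Rank1Residual.ManinAdditive
  Summit.BirchSwinnertonDyer.Rank1Residual.ManinAdditive.NeronCuspThree
  Summit.BirchSwinnertonDyer.Rank1Residual.ManinAdditive.NeronOmegaThree
  Summit.BirchSwinnertonDyer.Rank1Residual.ManinAdditive.NeronOmegaGenus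

namespace Summit.BirchSwinnertonDyer.Rank1Residual.ManinAdditive.NeronOmegaGenus

/-! ## §1 The mod-3 occurrence predicate and E-imc-173 / E-imc-174 (ENGINE 14, `9 ∥ N`) -/

/-- `x ∈ S₂(Γ₀(M); ℤ)` is a mod-3 Hecke eigenvector, non-zero mod 3, with eigenvalues `a ℓ (mod 3)` at the primes `ℓ ∤ 3M`
(i.e. the mod-3 eigensystem `a` OCCURS in `S₂(Γ₀(M)) ⊗ 𝔽₃`). -/
def IsModThreeEigenvectorFor (M : ℕ) [NeZero M] (a : ℕ → ℂ) (x : CuspForm (Gamma0 M) 2) : Prop :=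
  x ∈ integralCuspForms0 M 2 ∧ (¬ ∃ y ∈ integralCuspForms0 M 2, x = (3 : ℂ) • y) ∧
  ∀ (ℓ : ℕ) [NeZero ℓ], ℓ.Prime → ¬ ℓ ∣ 3 * M →
    ∃ y ∈ integralCuspForms0 M 2, heckeT (Gamma0 M) 2 ℓ x - a ℓ • x = (3 : ℂ) • y

/-- **E-imc-173 `OmegaDefectVisibleOnlyIfOldCongruentAtNine`** (E-facing NECESSARY condition, the per-curve shadow of the
Hecke-module law E-169/E-165: G₃ is supported on the `N/9`-old mod-3 eigensystems): for an optimal `E` with `9 ∥ N`, if the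
Ω-lattice loses a factor 3 on the `f`-line (`ord₃ [e_f Ω₃ : ℤf] < ord₃ deg φ`) then the mod-3 eigensystem of `f_E` occurs in
`S₂(Γ₀(N/9)) ⊗ 𝔽₃`.  BC5: ENGINE 14 (kit j326990) 59/59.  Why it might fail: only with E-169 (G a quotient Hecke module of
`S₂(Γ₀(N/9); 𝔽₃)`), i.e. beyond the certified range `N ≤ 1296`. -/
@[conjecture] def OmegaDefectVisibleOnlyIfOldCongruentAtNine : Prop :=
  ∀ (W : WeierstrassCurve ℚ) [W.IsElliptic] [W.IsGloballyMinimal] [NeZero (W.conductorNorm ℤ)]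
    (D : ModularParametrizationData W (W.conductorNorm ℤ)),
    (∀ z ∈ D.L.lattice, ∃ w ∈ periodLattice D.f, z = D.c * w) →
    (∀ (W' : WeierstrassCurve ℚ) [W'.IsElliptic]
        (D' : ModularParametrizationData W' (W.conductorNorm ℤ)),
        D'.f = D.f → D.modularDegree ≤ D'.modularDegree) →
    9 ∣ W.conductorNorm ℤ → ¬ 27 ∣ W.conductorNorm ℤ →
    padicValNat 3 (lineIndex (omegaLatticeAtThree (W.conductorNorm ℤ)) D.f) < padicValNat 3 D.modularDegree →
      ∀ [NeZero (W.conductorNorm ℤ / 9)], ∃ x : CuspForm (Gamma0 (W.conductorNorm ℤ / 9)) 2,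
        IsModThreeEigenvectorFor (W.conductorNorm ℤ / 9) (cuspCoeff D.f) x

/-- **E-imc-174 `OmegaDefectVisibleIffIIIstarAtNine`** (E-facing SHARP law at `9 ∥ N`, both directions; refines E-imc-153a,
whose class at `v₃(N) = 2` is exactly III*): for an optimal `E` with `9 ∥ N` the Ω-lattice loses a factor 3 on the `f`-line
iff the Kodaira symbol at 3 is III*.  BC5: ENGINE 7 + ENGINE 14: III* 59/59 lose one, III 102/102 and I_n* 345/345 lose
none (`N ≤ 1300`).  Reading (ENGINE 13/14): III* = twist-minimal at 3 (`w₃ = +1`) AND `ρ̄_{E,3}` of prime-to-3 Serre level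
(`N/9`-old) — the local invariant at 3 for `v₃(N) = 2`.  Why it might fail: a III* curve whose `N/9`-old congruence is
Eisenstein (rational 3-isogeny; none ≤ 1300) could keep full depth. -/
@[conjecture] def OmegaDefectVisibleIffIIIstarAtNine : Prop :=
  ∀ (W : WeierstrassCurve ℚ) [W.IsElliptic] [W.IsGloballyMinimal] [NeZero (W.conductorNorm ℤ)]
    (D : ModularParametrizationData W (W.conductorNorm ℤ)),
    (∀ z ∈ D.L.lattice, ∃ w ∈ periodLattice D.f, z = D.c * w) →
    (∀ (W' : WeierstrassCurve ℚ) [W'.IsElliptic]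
        (D' : ModularParametrizationData W' (W.conductorNorm ℤ)),
        D'.f = D.f → D.modularDegree ≤ D'.modularDegree) →
    9 ∣ W.conductorNorm ℤ → ¬ 27 ∣ W.conductorNorm ℤ →
      (padicValNat 3 (lineIndex (omegaLatticeAtThree (W.conductorNorm ℤ)) D.f) < padicValNat 3 D.modularDegree ↔
        W.kodairaSymbolAt placeThree = .IIIstar)

/-! ## §2 E-imc-175 (ENGINE 14d, `9 ∣ N`, `81 ∤ N`) -/

/-- **E-imc-175 `OmegaDefectVisibleOnlyIfOldCongruentAtThree`** (E-173 widened to `27 ∥ N`; ENGINE 14d kit j327077, 181 optimal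
curves at `27 ∥ N ≤ 1300`: the 72 with σ^Ω = 1 (II* 35, IV* 37) ALL have their mod-3 system in `S₂(Γ₀(N/9)) ⊗ 𝔽₃`; with ENGINE 14:
131/131 at `9 ∣ N`, `81 ∤ N`).  The converse fails exactly (i) on Eisenstein systems (rational 3-isogeny: 27 III, 31 II, 3 IV* curves
are `N/9`-old with full depth) and (ii) at `9 ∥ N` in the `w₃ = −1` sector (8 irreducible I_n* curves), cf. the E-170 corollary;
for irreducible `ρ̄_{E,3}` outside that sector it is an equivalence in the data (121/121 vs 0/375).  Why it might fail: only with
E-169 beyond `N ≤ 1296`. -/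
@[conjecture] def OmegaDefectVisibleOnlyIfOldCongruentAtThree : Prop :=
  ∀ (W : WeierstrassCurve ℚ) [W.IsElliptic] [W.IsGloballyMinimal] [NeZero (W.conductorNorm ℤ)]
    (D : ModularParametrizationData W (W.conductorNorm ℤ)),
    (∀ z ∈ D.L.lattice, ∃ w ∈ periodLattice D.f, z = D.c * w) →
    (∀ (W' : WeierstrassCurve ℚ) [W'.IsElliptic]
        (D' : ModularParametrizationData W' (W.conductorNorm ℤ)),
        D'.f = D.f → D.modularDegree ≤ D'.modularDegree) →
    9 ∣ W.conductorNorm ℤ → ¬ 81 ∣ W.conductorNorm ℤ →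
    padicValNat 3 (lineIndex (omegaLatticeAtThree (W.conductorNorm ℤ)) D.f) < padicValNat 3 D.modularDegree →
      ∀ [NeZero (W.conductorNorm ℤ / 9)], ∃ x : CuspForm (Gamma0 (W.conductorNorm ℤ / 9)) 2,
        IsModThreeEigenvectorFor (W.conductorNorm ℤ / 9) (cuspCoeff D.f) x

/-! ## §3 Typer edges (PROVED; DAG bookkeeping between E-153a, E-173, E-174, E-175) -/

/-- **E-175 ⟹ E-173:** the `81 ∤ N` law specialises to `27 ∤ N`. -/
theorem omegaDefectVisibleOnlyIfOldCongruentAtNine_of_atThree (h175 : OmegaDefectVisibleOnlyIfOldCongruentAtThree) :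
    OmegaDefectVisibleOnlyIfOldCongruentAtNine := by
  intro W _ _ _ D hL hopt h9 h27 hlt
  exact h175 W D hL hopt h9 (fun h81 => h27 ((by norm_num : (27 : ℕ) ∣ 81).trans h81)) hlt

/-- A curve of Kodaira type III* at `3` is in E-153a's Ω-defect class (`IsOmegaDefectClassAtThree`: exceptional star, and the IV*-proviso is vacuous). -/
theorem isOmegaDefectClassAtThree_of_IIIstar (W : WeierstrassCurve ℚ) (hIII : W.kodairaSymbolAt placeThree = .IIIstar) :
    IsOmegaDefectClassAtThree W :=
  ⟨Or.inr (Or.inl hIII), fun hIV => absurd (hIII.symm.trans hIV) (by decide)⟩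

/-- **E-153a ⟹ the «III* ⟹ visible» half of E-174 at `9 ∥ N`:** `OmegaDefectOfExceptionalStarAtThree` gives `depth + 1 = ord₃ deg φ` on the
defect class (which contains III*), hence `depth < ord₃ deg φ`. -/
theorem omegaDefectVisible_of_IIIstar_of_exceptionalStar (h153a : OmegaDefectOfExceptionalStarAtThree)
    (W : WeierstrassCurve ℚ) [W.IsElliptic] [W.IsGloballyMinimal] [NeZero (W.conductorNorm ℤ)]
    (D : ModularParametrizationData W (W.conductorNorm ℤ))
    (hL : ∀ z ∈ D.L.lattice, ∃ w ∈ periodLattice D.f, z = D.c * w)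
    (hopt : ∀ (W' : WeierstrassCurve ℚ) [W'.IsElliptic] (D' : ModularParametrizationData W' (W.conductorNorm ℤ)),
        D'.f = D.f → D.modularDegree ≤ D'.modularDegree)
    (h9 : 9 ∣ W.conductorNorm ℤ) (h27 : ¬ 27 ∣ W.conductorNorm ℤ) (hIII : W.kodairaSymbolAt placeThree = .IIIstar) :
    padicValNat 3 (lineIndex (omegaLatticeAtThree (W.conductorNorm ℤ)) D.f) < padicValNat 3 D.modularDegree := by
  have h := h153a W D hL hopt h9 (fun h81 => h27 ((by norm_num : (27 : ℕ) ∣ 81).trans h81))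
    (isOmegaDefectClassAtThree_of_IIIstar W hIII)
  omega

/-- **E-174 ⟹ consistency with E-153a's class:** at `9 ∥ N` a visible Ω-defect on the `f`-line forces Kodaira III*, hence the Ω-defect class. -/
theorem isOmegaDefectClassAtThree_of_visible (h174 : OmegaDefectVisibleIffIIIstarAtNine)
    (W : WeierstrassCurve ℚ) [W.IsElliptic] [W.IsGloballyMinimal] [NeZero (W.conductorNorm ℤ)]
    (D : ModularParametrizationData W (W.conductorNorm ℤ))
    (hL : ∀ z ∈ D.L.lattice, ∃ w ∈ periodLattice D.f, z = D.c * w)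
    (hopt : ∀ (W' : WeierstrassCurve ℚ) [W'.IsElliptic] (D' : ModularParametrizationData W' (W.conductorNorm ℤ)),
        D'.f = D.f → D.modularDegree ≤ D'.modularDegree)
    (h9 : 9 ∣ W.conductorNorm ℤ) (h27 : ¬ 27 ∣ W.conductorNorm ℤ)
    (hlt : padicValNat 3 (lineIndex (omegaLatticeAtThree (W.conductorNorm ℤ)) D.f) < padicValNat 3 D.modularDegree) :
    IsOmegaDefectClassAtThree W :=
  isOmegaDefectClassAtThree_of_IIIstar W ((h174 W D hL hopt h9 h27).mp hlt)

/-- **E-153a ∧ E-174 ⟹ the exact depth on the visible locus at `9 ∥ N`:** a visible defect is exactly ONE factor `3`. -/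
theorem omegaLineDepth_add_one_eq_of_visible (h153a : OmegaDefectOfExceptionalStarAtThree) (h174 : OmegaDefectVisibleIffIIIstarAtNine)
    (W : WeierstrassCurve ℚ) [W.IsElliptic] [W.IsGloballyMinimal] [NeZero (W.conductorNorm ℤ)]
    (D : ModularParametrizationData W (W.conductorNorm ℤ))
    (hL : ∀ z ∈ D.L.lattice, ∃ w ∈ periodLattice D.f, z = D.c * w)
    (hopt : ∀ (W' : WeierstrassCurve ℚ) [W'.IsElliptic] (D' : ModularParametrizationData W' (W.conductorNorm ℤ)),
        D'.f = D.f → D.modularDegree ≤ D'.modularDegree)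
    (h9 : 9 ∣ W.conductorNorm ℤ) (h27 : ¬ 27 ∣ W.conductorNorm ℤ)
    (hlt : padicValNat 3 (lineIndex (omegaLatticeAtThree (W.conductorNorm ℤ)) D.f) < padicValNat 3 D.modularDegree) :
    padicValNat 3 (lineIndex (omegaLatticeAtThree (W.conductorNorm ℤ)) D.f) + 1 = padicValNat 3 D.modularDegree :=
  h153a W D hL hopt h9 (fun h81 => h27 ((by norm_num : (27 : ℕ) ∣ 81).trans h81))
    (isOmegaDefectClassAtThree_of_visible h174 W D hL hopt h9 h27 hlt)

end Summit.BirchSwinnertonDyer.Rank1Residual.ManinAdditive.NeronOmegaGenus
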